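import Summits.HodgeConjecture.CorCM.IrreducibleOddWeightsIndexParityCMFields
import HarnessLib

/-!
# Index parity, IV (CM fields): EVEN INDEX — the fibre-twisted types `Φ^{(y₀)}` of `K₀ ⊇ T` exist, and their defect
# against ANY partner is the space of LEFT-`Aut(ℂ/y₀T)`-INVARIANT matrix coefficients of the partner

COR-CM (cell `pub-hodgecm2`, binder seat `b16` gen 68, count-neutral claim INDEX PARITY, file P3; theorems only, no
definition, no named fact, no `sorry`).  NEW as stated, hence under `Summits/`.  HONEST FRAMING: Galois theory of CM
fields inside `ℂ` and finite combinatorics of CM types with consequences for `dim MT(A₀ × A₁)` of abelian varieties with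
complex multiplication; nothing is claimed about the algebraicity of Hodge classes; `HC_CM` is neither used nor asserted.

SETTING (files P1–P2).  `T ⊆ K_{i₀}` a subfield without real embeddings, `f₀ = [K_{i₀} : T]`, `ρ` = complex conjugation,
`y₀ : T → ℂ`.  When `f₀` is EVEN the weight `f₀·(δ_{y₀} − δ_{ȳ₀})` is admissible (P2 surjectivity), so `K_{i₀}` has
a **FIBRE-TWISTED TYPE `Φ^{(y₀)}`**: all `f₀` embeddings over `y₀`, none over `ȳ₀`, half of every other fibre
(`exists_cmType_twisted_shadow`) — impossible for odd `f₀` when `[T:ℚ] > 2` (P2 `shadow_ne_zero_of_odd_finrank`).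

* §1 Left-oddness of matrix coefficients (`antiVec_conj_mul`, `apply_conj_mul_eq_neg_of_mem_span_coeff`) and
  commutation of `ρ` with `Aut(ℂ)` on `Hom(T, ℂ)` for `T` inside a CM field (`smul_conj_smul_restrict`).
* §2 **THE `F`-SPACE OF THE TWISTED SHADOW** is the space of functions on `Aut(ℂ)` that are LEFT-INVARIANT under the
  stabiliser `Aut(ℂ/y₀T) = {h | h ∘ y₀ = y₀}` and LEFT-ODD under `ρ` (`mem_span_twistedShadowCoeff_iff`: `⊆` by
  inspection, `⊇` by transitivity of `Aut(ℂ)` on `Hom(T, ℂ)` — `c = (2f₀)⁻¹ Σ_z c(g_z)·s_z`).  Hence (P2 §2) **the defect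
  `dim Hg(A^{(y₀)}) + dim Hg(A₁) − dim Hg(A^{(y₀)} × A₁)` is the dimension of the LEFT-`Aut(ℂ/y₀T)`-INVARIANT part of
  `MC₁ = span{g ↦ u₁(g ∘ x)}`** (`mem_twistedShadowCoeff_inf_iff`; in Mumford–Tate terms: the characters of `Hg(A₁)`
  defined over `y₀(T)`), whenever `T` contains the trace (TR).
* §3 (sequel `IrreducibleOddWeightsIndexParityAbsorption`) TOTAL ABSORPTION: if `y₀(T) ⊇ L₁` then
  `dim MT(A^{(y₀)} × A₁) = dim MT(A^{(y₀)})` for EVERY CM type of `K_{i₁}`.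

## References

* [Gordon1999HodgeAVSurvey] B. B. Gordon, *A survey of the Hodge conjecture for abelian varieties*, §3 Theorem (proof),
  7.5–7.7, 9.4.3.
* [Lang2002] S. Lang, *Algebra*, 3rd ed., VI §1 Thm. 1.1, Cor. 1.6, Thm. 1.12, V §2 Thm. 2.8.
* [Shimura1998] G. Shimura, *Abelian Varieties with Complex Multiplication and Modular Functions*, §8.1, §8.3, §18.1.
* [Deligne1982HodgeCycles] P. Deligne, *Hodge cycles on abelian varieties*, LNM 900, I.3.4, I Ex. 3.7 (c).
-/

set_option autoImplicit false

noncomputable section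

open scoped BigOperators Classical

open CategoryTheory CategoryTheory.Limits NumberField Module IntermediateField

namespace Summit.HodgeConjecture.CorCM

open Literature.NumberTheory.ComplexMultiplication
open Literature.AlgebraicGeometry.Motives (AbelianVariety CMType)
open Literature.AlgebraicGeometry.Motives.AbelianVariety
open Literature.AlgebraicGeometry.HodgeTheory
open Literature.AlgebraicGeometry.ComplexMultiplication (IsCMTypeRealisation)
open Literature.AlgebraicGeometry.Pohlmann1968

/-! ### §1 Left-oddness; conjugation commutes with `Aut(ℂ)` on the embeddings of a subfield of a CM field -/

section Odd

variable {K₁ : Type} [Field K₁] [NumberField K₁] [IsCMField K₁]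

/-- `u₁((ρg) ∘ x) = −u₁(g ∘ x)`: a translate by `ρg` is the complement of the translate by `g`.
[cite: Shimura1998, §18.1] -/
theorem antiVec_conj_mul (Φ₁ : CMType K₁) (g : ℂ ≃+* ℂ) (x : K₁ →+* ℂ) :
    antiVec Φ₁.1 ((starRingAut : ℂ ≃+* ℂ) * g) x = -antiVec Φ₁.1 g x := by
  have h := isCMTypeWith_conj Φ₁
  simp only [antiVec, translateInd, mul_smul]
  by_cases hx : g • x ∈ Φ₁.1
  · have : (starRingAut : ℂ ≃+* ℂ) • g • x ∉ Φ₁.1 := (h.mem_iff _).1 hx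
    rw [if_pos hx, if_neg this]
    norm_num
  · have : (starRingAut : ℂ ≃+* ℂ) • g • x ∈ Φ₁.1 := (h.rho_smul_mem_iff _).2 hx
    rw [if_neg hx, if_pos this]
    norm_num

/-- **Matrix coefficients are LEFT-ODD under conjugation**: `c(ρg) = −c(g)` for every `c ∈ MC₁`.
[cite: Shimura1998, §18.1] [cite: Deligne1982HodgeCycles, I Ex. 3.7 (c)] -/
theorem apply_conj_mul_eq_neg_of_mem_span_coeff (Φ₁ : CMType K₁) {c : (ℂ ≃+* ℂ) → ℚ}
    (hc : c ∈ Submodule.span ℚ (Set.range fun x : K₁ →+* ℂ => fun g : ℂ ≃+* ℂ => antiVec Φ₁.1 g x))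
    (g : ℂ ≃+* ℂ) : c ((starRingAut : ℂ ≃+* ℂ) * g) = -c g := by
  induction hc using Submodule.span_induction generalizing g with
  | mem c hc =>
    obtain ⟨x, rfl⟩ := hc
    exact antiVec_conj_mul Φ₁ g x
  | zero => simp
  | add c c' _ _ hc hc' => rw [Pi.add_apply, Pi.add_apply, hc, hc', neg_add]
  | smul a c _ hc => rw [Pi.smul_apply, Pi.smul_apply, hc, smul_eq_mul, smul_eq_mul, mul_neg]

/-- For a subfield `T` of a CM field `K₀`, conjugation commutes with every automorphism of `ℂ` on `Hom(T, ℂ)` (extend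
the embedding to `K₀`, where it does). [cite: Shimura1998, §18.1 and §18.2 Lemma (i)] -/
theorem smul_conj_smul_restrict (K₀ : Type) [Field K₀] [NumberField K₀] [IsCMField K₀] {T : Type} [Field T]
    [Algebra T K₀] (g : ℂ ≃+* ℂ) (y : T →+* ℂ) :
    g • (starRingAut : ℂ ≃+* ℂ) • y = (starRingAut : ℂ ≃+* ℂ) • g • y := by
  obtain ⟨Ψ⟩ := nonempty_cmType_of_isCMField (K₀ := K₀)
  obtain ⟨t, rfl⟩ := restrict_surjective (algebraMap T K₀) y
  change ((g • (starRingAut : ℂ ≃+* ℂ) • t).comp (algebraMap T K₀)) =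
    (((starRingAut : ℂ ≃+* ℂ) • g • t).comp (algebraMap T K₀))
  rw [(isCMTypeWith_conj Ψ).comm g t]

end Odd

/-! ### §2 The `F`-space of the twisted shadow: left-invariant, left-odd functions -/

section Twisted

variable {K₀ : Type} [Field K₀] [NumberField K₀] [IsCMField K₀] {T : Type} [Field T] [NumberField T]
  [Algebra T K₀]

omit [IsCMField K₀] [NumberField T] in
/-- The matrix coefficient of the twisted shadow at `y`: `g ↦ f₀·([g ∘ y = y₀] − [g ∘ y = ȳ₀])`. [folklore] -/
theorem twistedShadowCoeff_apply (Φ₀ : CMType K₀) (y₀ : T →+* ℂ)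
    (htw : ∀ y : T →+* ℂ,
      ∑ t ∈ Finset.univ.filter (fun t : K₀ →+* ℂ => t.comp (algebraMap T K₀) = y), antiVec Φ₀.1 (1 : ℂ ≃+* ℂ) t =
        (Module.finrank T K₀ : ℚ) *
          ((if y = y₀ then 1 else 0) - (if y = (starRingAut : ℂ ≃+* ℂ) • y₀ then 1 else 0)))
    (y : T →+* ℂ) (g : ℂ ≃+* ℂ) :
    ∑ t ∈ Finset.univ.filter (fun t : K₀ →+* ℂ => t.comp (algebraMap T K₀) = g • y),
        antiVec Φ₀.1 (1 : ℂ ≃+* ℂ) t =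
      (Module.finrank T K₀ : ℚ) *
        ((if g • y = y₀ then 1 else 0) - (if g • y = (starRingAut : ℂ ≃+* ℂ) • y₀ then 1 else 0)) :=
  htw (g • y)

omit [NumberField T] in
/-- **`⊆`: every element of the `F`-space of the twisted shadow is LEFT-INVARIANT under `Aut(ℂ/y₀T)` and LEFT-ODD
under `ρ`.** [cite: Lang2002, VI §1 Thm. 1.1] [cite: Shimura1998, §18.1] -/
theorem left_invariant_of_mem_span_twistedShadowCoeff (Φ₀ : CMType K₀) (y₀ : T →+* ℂ)
    (htw : ∀ y : T →+* ℂ,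
      ∑ t ∈ Finset.univ.filter (fun t : K₀ →+* ℂ => t.comp (algebraMap T K₀) = y), antiVec Φ₀.1 (1 : ℂ ≃+* ℂ) t =
        (Module.finrank T K₀ : ℚ) *
          ((if y = y₀ then 1 else 0) - (if y = (starRingAut : ℂ ≃+* ℂ) • y₀ then 1 else 0)))
    {c : (ℂ ≃+* ℂ) → ℚ}
    (hc : c ∈ Submodule.span ℚ (Set.range fun y : T →+* ℂ => fun g : ℂ ≃+* ℂ =>
      ∑ t ∈ Finset.univ.filter (fun t : K₀ →+* ℂ => t.comp (algebraMap T K₀) = g • y),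
        antiVec Φ₀.1 (1 : ℂ ≃+* ℂ) t)) :
    (∀ h : ℂ ≃+* ℂ, h • y₀ = y₀ → ∀ g : ℂ ≃+* ℂ, c (h * g) = c g) ∧
      ∀ g : ℂ ≃+* ℂ, c ((starRingAut : ℂ ≃+* ℂ) * g) = -c g := by
  induction hc using Submodule.span_induction with
  | mem c hc =>
    obtain ⟨y, rfl⟩ := hc
    constructor
    · intro h hh g
      simp only [twistedShadowCoeff_apply Φ₀ y₀ htw, mul_smul]
      have hinv' : h⁻¹ • y₀ = y₀ := inv_smul_eq_iff.2 hh.symm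
      have h1 : h • g • y = y₀ ↔ g • y = y₀ := by
        constructor
        · intro he
          rw [← hinv']
          exact eq_inv_smul_iff.2 he
        · intro he
          rw [he, hh]
      have hh' : h • (starRingAut : ℂ ≃+* ℂ) • y₀ = (starRingAut : ℂ ≃+* ℂ) • y₀ := by
        rw [smul_conj_smul_restrict K₀, hh]
      have hinv'' : h⁻¹ • (starRingAut : ℂ ≃+* ℂ) • y₀ = (starRingAut : ℂ ≃+* ℂ) • y₀ :=
        inv_smul_eq_iff.2 hh'.symm
      have h2 : h • g • y = (starRingAut : ℂ ≃+* ℂ) • y₀ ↔ g • y = (starRingAut : ℂ ≃+* ℂ) • y₀ := by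
        constructor
        · intro he
          rw [← hinv'']
          exact eq_inv_smul_iff.2 he
        · intro he
          rw [he, hh']
      simp only [h1, h2]
    · intro g
      simp only [twistedShadowCoeff_apply Φ₀ y₀ htw, mul_smul]
      have h1 : (starRingAut : ℂ ≃+* ℂ) • g • y = y₀ ↔ g • y = (starRingAut : ℂ ≃+* ℂ) • y₀ := by
        constructor
        · intro he
          have := congrArg (fun z => (starRingAut : ℂ ≃+* ℂ) • z) he
          simpa only [conj_smul_conj_smul_eq] using this
        · intro he
          rw [he, conj_smul_conj_smul_eq]
      have h2 : (starRingAut : ℂ ≃+* ℂ) • g • y = (starRingAut : ℂ ≃+* ℂ) • y₀ ↔ g • y = y₀ := by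
        constructor
        · intro he
          have := congrArg (fun z => (starRingAut : ℂ ≃+* ℂ) • z) he
          simpa only [conj_smul_conj_smul_eq] using this
        · intro he
          rw [he]
      simp only [h1, h2]
      ring
  | zero => exact ⟨fun _ _ _ => rfl, fun _ => by simp⟩
  | add c c' _ _ hc hc' =>
    exact ⟨fun h hh g => by rw [Pi.add_apply, Pi.add_apply, hc.1 h hh g, hc'.1 h hh g],
      fun g => by rw [Pi.add_apply, Pi.add_apply, hc.2 g, hc'.2 g, neg_add]⟩
  | smul a c _ hc =>
    exact ⟨fun h hh g => by rw [Pi.smul_apply, Pi.smul_apply, hc.1 h hh g],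
      fun g => by rw [Pi.smul_apply, Pi.smul_apply, hc.2 g, smul_eq_mul, smul_eq_mul, mul_neg]⟩

omit [IsCMField K₀] in
/-- **`⊇`: every LEFT-`Aut(ℂ/y₀T)`-INVARIANT, LEFT-`ρ`-ODD function on `Aut(ℂ)` lies in the `F`-space of the twisted
shadow** (`Aut(ℂ)` is transitive on `Hom(T, ℂ)`: with `g_z ∘ z = y₀`, `c = (2f₀)⁻¹ Σ_z c(g_z)·s_z`).
[cite: Lang2002, V §2 Thm. 2.8 and VI §1 Thm. 1.1] [cite: Gordon1999HodgeAVSurvey, §3 Theorem (proof)] -/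
theorem mem_span_twistedShadowCoeff_of_left_invariant (Φ₀ : CMType K₀) (y₀ : T →+* ℂ)
    (htw : ∀ y : T →+* ℂ,
      ∑ t ∈ Finset.univ.filter (fun t : K₀ →+* ℂ => t.comp (algebraMap T K₀) = y), antiVec Φ₀.1 (1 : ℂ ≃+* ℂ) t =
        (Module.finrank T K₀ : ℚ) *
          ((if y = y₀ then 1 else 0) - (if y = (starRingAut : ℂ ≃+* ℂ) • y₀ then 1 else 0)))
    {c : (ℂ ≃+* ℂ) → ℚ} (hinv : ∀ h : ℂ ≃+* ℂ, h • y₀ = y₀ → ∀ g : ℂ ≃+* ℂ, c (h * g) = c g)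
    (hodd : ∀ g : ℂ ≃+* ℂ, c ((starRingAut : ℂ ≃+* ℂ) * g) = -c g) :
    c ∈ Submodule.span ℚ (Set.range fun y : T →+* ℂ => fun g : ℂ ≃+* ℂ =>
      ∑ t ∈ Finset.univ.filter (fun t : K₀ →+* ℂ => t.comp (algebraMap T K₀) = g • y),
        antiVec Φ₀.1 (1 : ℂ ≃+* ℂ) t) := by
  haveI := isPretransitive_ringEquiv_complex (K := T)
  have hf : (Module.finrank T K₀ : ℚ) ≠ 0 := by exact_mod_cast Module.finrank_pos.ne'
  -- a section of the orbit map: `sec z ∘ z = y₀`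
  have hsec : ∀ z : T →+* ℂ, ∃ g : ℂ ≃+* ℂ, g • z = y₀ := fun z => MulAction.exists_smul_eq (ℂ ≃+* ℂ) z y₀
  choose sec hsec using hsec
  -- the value of `c` on `g` only depends on `g⁻¹ ∘ y₀`
  have hval : ∀ g : ℂ ≃+* ℂ, c (sec (g⁻¹ • y₀)) = c g := by
    intro g
    have hh : (sec (g⁻¹ • y₀) * g⁻¹) • y₀ = y₀ := by rw [mul_smul, hsec]
    have := hinv _ hh g
    rwa [inv_mul_cancel_right] at this
  have hval' : ∀ g : ℂ ≃+* ℂ, c (sec (g⁻¹ • (starRingAut : ℂ ≃+* ℂ) • y₀)) = -c g := by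
    intro g
    have hh : (sec (g⁻¹ • (starRingAut : ℂ ≃+* ℂ) • y₀) * g⁻¹ * (starRingAut : ℂ ≃+* ℂ)) • y₀ = y₀ := by
      rw [mul_smul, mul_smul, hsec]
    have h1 := hinv _ hh ((starRingAut : ℂ ≃+* ℂ)⁻¹ * g)
    rw [show sec (g⁻¹ • (starRingAut : ℂ ≃+* ℂ) • y₀) * g⁻¹ * (starRingAut : ℂ ≃+* ℂ) *
        ((starRingAut : ℂ ≃+* ℂ)⁻¹ * g) = sec (g⁻¹ • (starRingAut : ℂ ≃+* ℂ) • y₀) by group] at h1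
    have h2 := hodd ((starRingAut : ℂ ≃+* ℂ)⁻¹ * g)
    rw [← mul_assoc, mul_inv_cancel, one_mul] at h2
    rw [h1]
    linarith
  -- the explicit combination
  have hcomb : c = ∑ z : T →+* ℂ, ((2 * (Module.finrank T K₀ : ℚ))⁻¹ * c (sec z)) •
      fun g : ℂ ≃+* ℂ => ∑ t ∈ Finset.univ.filter (fun t : K₀ →+* ℂ => t.comp (algebraMap T K₀) = g • z),
        antiVec Φ₀.1 (1 : ℂ ≃+* ℂ) t := by
    funext g
    simp only [Finset.sum_apply, Pi.smul_apply, smul_eq_mul, twistedShadowCoeff_apply Φ₀ y₀ htw, mul_sub,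
      Finset.sum_sub_distrib, mul_ite, mul_one, mul_zero]
    have e1 : ∀ z : T →+* ℂ, (g • z = y₀) = (z = g⁻¹ • y₀) := fun z => by
      rw [eq_inv_smul_iff]
    have e2 : ∀ z : T →+* ℂ, (g • z = (starRingAut : ℂ ≃+* ℂ) • y₀) =
        (z = g⁻¹ • (starRingAut : ℂ ≃+* ℂ) • y₀) := fun z => by
      rw [eq_inv_smul_iff]
    simp only [e1, e2, Finset.sum_ite_eq', Finset.mem_univ, if_true, hval, hval']
    field_simp
    ring
  rw [hcomb]
  exact Submodule.sum_mem _ fun z _ => Submodule.smul_mem _ _ (Submodule.subset_span ⟨z, rfl⟩)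

/-- **THE `F`-SPACE OF THE TWISTED SHADOW = {left-`Aut(ℂ/y₀T)`-invariant, left-`ρ`-odd functions}.**
[cite: Lang2002, V §2 Thm. 2.8 and VI §1 Thm. 1.1] [cite: Shimura1998, §18.1] -/
theorem mem_span_twistedShadowCoeff_iff (Φ₀ : CMType K₀) (y₀ : T →+* ℂ)
    (htw : ∀ y : T →+* ℂ,
      ∑ t ∈ Finset.univ.filter (fun t : K₀ →+* ℂ => t.comp (algebraMap T K₀) = y), antiVec Φ₀.1 (1 : ℂ ≃+* ℂ) t =
        (Module.finrank T K₀ : ℚ) *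
          ((if y = y₀ then 1 else 0) - (if y = (starRingAut : ℂ ≃+* ℂ) • y₀ then 1 else 0)))
    (c : (ℂ ≃+* ℂ) → ℚ) :
    c ∈ Submodule.span ℚ (Set.range fun y : T →+* ℂ => fun g : ℂ ≃+* ℂ =>
        ∑ t ∈ Finset.univ.filter (fun t : K₀ →+* ℂ => t.comp (algebraMap T K₀) = g • y),
          antiVec Φ₀.1 (1 : ℂ ≃+* ℂ) t) ↔
      (∀ h : ℂ ≃+* ℂ, h • y₀ = y₀ → ∀ g : ℂ ≃+* ℂ, c (h * g) = c g) ∧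
        ∀ g : ℂ ≃+* ℂ, c ((starRingAut : ℂ ≃+* ℂ) * g) = -c g :=
  ⟨left_invariant_of_mem_span_twistedShadowCoeff Φ₀ y₀ htw,
    fun h => mem_span_twistedShadowCoeff_of_left_invariant Φ₀ y₀ htw h.1 h.2⟩

variable {K₁ : Type} [Field K₁] [NumberField K₁] [IsCMField K₁]

/-- **THE DEFECT SPACE OF A TWISTED TYPE AGAINST ANY PARTNER = the LEFT-`Aut(ℂ/y₀T)`-INVARIANT matrix coefficients of
the partner**: `c ∈ F ∩ MC₁ ⟺ c ∈ MC₁ ∧ c(hg) = c(g)` for all `h ∘ y₀ = y₀` (oddness is automatic on `MC₁`).  With P2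
§2: `dim Hg(A^{(y₀)}) + dim Hg(A₁) − dim Hg(A^{(y₀)} × A₁) = dim{c ∈ MC₁ | c left-invariant under Aut(ℂ/y₀T)}` — in
Mumford–Tate terms the rank of the group of characters of `Hg(A₁)` defined over `y₀(T)`.
[cite: Gordon1999HodgeAVSurvey, §3 Theorem (proof) and 7.5–7.7] [cite: Deligne1982HodgeCycles, I.3.4 and I Ex. 3.7 (c)] -/
theorem mem_twistedShadowCoeff_inf_iff (Φ₀ : CMType K₀) (y₀ : T →+* ℂ)
    (htw : ∀ y : T →+* ℂ,
      ∑ t ∈ Finset.univ.filter (fun t : K₀ →+* ℂ => t.comp (algebraMap T K₀) = y), antiVec Φ₀.1 (1 : ℂ ≃+* ℂ) t =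
        (Module.finrank T K₀ : ℚ) *
          ((if y = y₀ then 1 else 0) - (if y = (starRingAut : ℂ ≃+* ℂ) • y₀ then 1 else 0)))
    (Φ₁ : CMType K₁) (c : (ℂ ≃+* ℂ) → ℚ) :
    c ∈ Submodule.span ℚ (Set.range fun y : T →+* ℂ => fun g : ℂ ≃+* ℂ =>
          ∑ t ∈ Finset.univ.filter (fun t : K₀ →+* ℂ => t.comp (algebraMap T K₀) = g • y),
            antiVec Φ₀.1 (1 : ℂ ≃+* ℂ) t) ⊓
        Submodule.span ℚ (Set.range fun x : K₁ →+* ℂ => fun g : ℂ ≃+* ℂ => antiVec Φ₁.1 g x) ↔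
      c ∈ Submodule.span ℚ (Set.range fun x : K₁ →+* ℂ => fun g : ℂ ≃+* ℂ => antiVec Φ₁.1 g x) ∧
        ∀ h : ℂ ≃+* ℂ, h • y₀ = y₀ → ∀ g : ℂ ≃+* ℂ, c (h * g) = c g := by
  rw [Submodule.mem_inf, mem_span_twistedShadowCoeff_iff Φ₀ y₀ htw]
  constructor
  · rintro ⟨⟨hinv, -⟩, hc⟩
    exact ⟨hc, hinv⟩
  · rintro ⟨hc, hinv⟩
    exact ⟨⟨hinv, apply_conj_mul_eq_neg_of_mem_span_coeff Φ₁ hc⟩, hc⟩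

/-- **EXISTENCE OF THE TWISTED TYPES FOR EVEN INDEX**: `[K₀ : T]` even, `T` without real embeddings ⟹ for every
`y₀` there is a CM type of `K₀` with shadow `[K₀:T]·(δ_{y₀} − δ_{ȳ₀})` (all embeddings over `y₀`, none over `ȳ₀`, half
of every other fibre). [cite: Gordon1999HodgeAVSurvey, 9.4.3] [cite: Shimura1998, §18.1] -/
theorem exists_cmType_twisted_shadow [IsTotallyComplex T] (heven : Even (Module.finrank T K₀)) (y₀ : T →+* ℂ) :
    ∃ Φ₀ : CMType K₀, ∀ y : T →+* ℂ,
      ∑ t ∈ Finset.univ.filter (fun t : K₀ →+* ℂ => t.comp (algebraMap T K₀) = y), antiVec Φ₀.1 (1 : ℂ ≃+* ℂ) t =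
        (Module.finrank T K₀ : ℚ) *
          ((if y = y₀ then 1 else 0) - (if y = (starRingAut : ℂ ≃+* ℂ) • y₀ then 1 else 0)) := by
  obtain ⟨m, hm⟩ := heven
  have hy₀ : (starRingAut : ℂ ≃+* ℂ) • y₀ ≠ y₀ := conj_smul_ne_of_isTotallyComplex y₀
  have hy₀' : y₀ ≠ (starRingAut : ℂ ≃+* ℂ) • y₀ := fun h => hy₀ h.symm
  obtain ⟨Φ₀, hΦ₀⟩ := exists_cmType_forall_shadow_eq (K₀ := K₀) (T := T)
    (fun y => if y = y₀ then Module.finrank T K₀ else if y = (starRingAut : ℂ ≃+* ℂ) • y₀ then 0 else m)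
    fun y => by
      by_cases h1 : y = y₀
      · simp only [h1, if_true, if_neg hy₀, add_zero]
      · by_cases h2 : y = (starRingAut : ℂ ≃+* ℂ) • y₀
        · simp only [h2, conj_smul_conj_smul_eq, if_true, if_neg hy₀, zero_add]
        · have h3 : (starRingAut : ℂ ≃+* ℂ) • y ≠ y₀ := fun h => h2 (by rw [← h, conj_smul_conj_smul_eq])
          have h4 : (starRingAut : ℂ ≃+* ℂ) • y ≠ (starRingAut : ℂ ≃+* ℂ) • y₀ := fun h => h1 (by
            have := congrArg (fun z => (starRingAut : ℂ ≃+* ℂ) • z) h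
            simpa only [conj_smul_conj_smul_eq] using this)
          simp only [if_neg h1, if_neg h2, if_neg h3, if_neg h4]
          omega
  refine ⟨Φ₀, fun y => ?_⟩
  rw [hΦ₀ y]
  by_cases h1 : y = y₀
  · simp only [h1, if_true, if_neg hy₀']
    ring
  · by_cases h2 : y = (starRingAut : ℂ ≃+* ℂ) • y₀
    · simp only [h2, if_neg hy₀, if_true]
      push_cast
      ring
    · simp only [if_neg h1, if_neg h2, hm]
      push_cast
      ring

end Twisted

end Summit.HodgeConjecture.CorCM

end
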